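import Literature.NumberTheory.QuadraticForms.HilbertSymbolPrescribedHolds
import Literature.NumberTheory.QuadraticForms.HilbertSymbolPrescribedProofs
import Literature.NumberTheory.QuadraticForms.NormIndexSecondInequalityProofs
import Literature.NumberTheory.QuadraticForms.LocalNormIndex
import Literature.NumberTheory.QuadraticForms.IdeleSquareIndexProofs
import HarnessLib

/-!
# Exactness of the quadratic norm-residue sequence on idèles: `x ∈ Kˣ · N_{M/K}(𝔸_Mˣ)` iff the total norm-residue
# symbol `∏_v (a, x_v)_v` is `+1` (`M = K(√a)`; O'Meara §65A, §71 Thm. 71:18–71:19; Tate, Cassels–Fröhlich VII §6)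

Topic `NumberTheory/GaloisRepresentations` (global class field theory, quadratic case); namespace
`Literature.NumberTheory.GaloisRepresentations`.  THEOREMS ONLY (no definition, no named fact, no instance, no `sorry`); net
debt 0: everything rests on the tree's PROVED Hilbert reciprocity law (O'Meara 71:18, `QuadraticForms.hilbertReciprocity_holds`)
and on O'Meara 71:19∕71:19a «elements with prescribed local Hilbert symbols» (`QuadraticForms.exists_hilbertSymbol_eq_neg_one_iff_holds`),
read in the idèle letters of `QuadraticForms/QuadraticNormIndex` (`ideleGroup K = 𝔸_Kˣ`, `principalIdeles K = Kˣ`, `normIdeles K a =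
N_{M/K} 𝔸_Mˣ` = the idèles that are local norms from `K_v(√a)` at every finite and every infinite place, `ideleFiniteComponent`,
`ideleInfiniteComponent`, `quadraticNormSubgroup`).

## The statement

For a number field `K`, `a ∈ K` NOT a square (so `M = K(√a)` is a quadratic extension) and an idèle `i ∈ 𝔸_Kˣ`, call a place `v`
(finite or infinite) BAD for `i` when `i_v` is not a local norm from `M_w = K_v(√a)`, i.e. when the norm-residue ∕ Hilbert symbol
`(i_v, a)_v` is `−1` (O'Meara §65A: «`α ∈ F_𝔭ˣ` is a local norm at `𝔭` iff `(α, θ)_𝔭 = 1`»).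

* `finite_setOf_ideleFiniteComponent_not_mem_quadraticNormSubgroup` — the bad finite places of any idèle are FINITE (at a non-dyadic
  place where `a` and `i_v` are units, units are norms: O'Meara Example 63:12 ∕ 65:4, ★ `mem_quadraticNormSubgroup_of_valued_eq_one`);
* **`mem_principalIdeles_sup_normIdeles_iff_even`** — `i ∈ Kˣ · N_{M/K}(𝔸_Mˣ)` **iff the number of bad places (finite + infinite)
  is EVEN**, i.e. iff the total norm-residue symbol `∏_v (i_v, a)_v ∈ {±1}` equals `+1`: this is the exactness of
  `1 → Kˣ N(𝔸_Mˣ) → 𝔸_Kˣ → Gal(M/K) → 1` at the middle term (the idèle-theoretic Artin map of the quadratic extension is the total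
  norm-residue symbol; its kernel is `Kˣ N(𝔸_Mˣ)`, [Tate, Cassels–Fröhlich Ch. VII §6, Thm. 6.3 with §5.1 (B)]), obtained here from
  O'Meara's quadratic-form road: (→) a principal idèle `(θ)` times a norm idèle is bad exactly where `(θ, a)_v = −1`, an even number of
  places by reciprocity 71:18 (★ `even_card_of_mem_principalIdeles_sup_normIdeles`); (←) 71:19a gives `θ ∈ Kˣ` with `(θ, a)_v = −1`
  exactly at the bad places (`a` is a local non-square there, since a local square makes every unit a local norm, and bad infinite
  places are real), and then `(θ)⁻¹ · i` is a local norm everywhere (the local norm groups have index `≤ 2`: ★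
  `index_quadraticNormSubgroup_adicCompletion_eq_two`, and index `2` at real places where `a < 0`).
* `mem_principalIdeles_sup_normIdeles_iff_prod_hilbertSymbol_eq_one` — the same with the total symbol written as a finite product
  `∏_{v ∈ S} (i_v, a)_v · ∏_{w ∈ T} (i_w, a)_w = 1` over any finite sets `S ⊇` bad finite places, `T ⊇` bad infinite places.

USE (cell hodgecm-mathlib, floor-0 line `F0_T1InnerFormTraceIdentity`, G6 «Hasse for the U(3) tori», rows R4→R6): the obstruction
`obs(δ)` of an adelic class in a regular stable class of the unitary group `U(H)` is the total norm-residue symbol of its Cartan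
invariant, and Kottwitz's criterion (Rogawski 1990, Prop. 3.3.1: `δ` is rational iff `κ(obs δ) = 1` for all `κ`) is this exactness
applied factor by factor in the Cartan algebra.

## References
* O. T. O'Meara, *Introduction to Quadratic Forms*, Grundlehren 117 (1963), §63B Example 63:12, §65A Examples 65:1–65:4, §71
  Thm. 71:18, Thm. 71:19 and Cor. 71:19a. [Omeara1963]
* J. Tate, *Global class field theory*, Ch. VII in J. W. S. Cassels, A. Fröhlich (eds.), *Algebraic Number Theory* (1967), §5.1 (B),
  §6 Thm. 6.3. [CasselsFrohlichANT1967]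
* J. D. Rogawski, *Automorphic Representations of Unitary Groups in Three Variables*, Ann. of Math. Stud. 123 (1990), §3.3
  Prop. 3.3.1, §5.4 p. 72. [Rogawski1990]
-/

set_option autoImplicit false

noncomputable section

open NumberField IsDedekindDomain

namespace Literature.NumberTheory.GaloisRepresentations

open Literature.NumberTheory.QuadraticForms Literature.NumberTheory.QuadraticForms.OMeara65

variable (K : Type) [Field K] [NumberField K]

/-! ## §1 The bad places of an idèle are finite -/

variable {K} in
/-- **The bad finite places of an idèle are finite**: for `a ≠ 0` and `i ∈ 𝔸_Kˣ`, `i_v` is a local norm from `K_v(√a)` at all but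
finitely many finite places `v` — at a non-dyadic `v` where `a` and `i_v` are units, units are norms (O'Meara Example 63:12 ∕ 65:4).
[cite: Omeara1963, §65A Example 65:4] [cite: Omeara1963, §63B Example 63:12] -/
theorem finite_setOf_ideleFiniteComponent_not_mem_quadraticNormSubgroup {a : K} (ha : a ≠ 0) (i : ideleGroup K) :
    {v : HeightOneSpectrum (𝓞 K) | ideleFiniteComponent K v i ∉
      quadraticNormSubgroup (v.adicCompletion K) (algebraMap K (v.adicCompletion K) a)}.Finite := by
  -- `a` is a unit at almost all places
  have hau : IsUnit (algebraMap K (FiniteAdeleRing (𝓞 K) K) a) := (isUnit_iff_ne_zero.2 ha).map _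
  have hea : ∀ᶠ v : HeightOneSpectrum (𝓞 K) in Filter.cofinite, v.valuation K a = 1 := by
    filter_upwards [(FiniteAdeleRing.isUnit_iff.1 hau).2] with v hv
    rw [← valued_algebraMap_adicCompletion]
    exact hv
  -- `i_v` is a unit at almost all places
  have hiu : IsUnit ((i : AdeleRing (𝓞 K) K).2) :=
    i.isUnit.map (RingHom.snd (InfiniteAdeleRing K) (FiniteAdeleRing (𝓞 K) K))
  have hei : ∀ᶠ v : HeightOneSpectrum (𝓞 K) in Filter.cofinite, Valued.v ((i : AdeleRing (𝓞 K) K).2 v) = 1 :=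
    (FiniteAdeleRing.isUnit_iff.1 hiu).2
  -- `2` is a unit at almost all places
  have he2 : ∀ᶠ v : HeightOneSpectrum (𝓞 K) in Filter.cofinite, (2 : 𝓞 K) ∉ v.asIdeal :=
    Filter.eventually_cofinite.2 (by simpa only [not_not] using finite_setOf_two_mem (K := K))
  have h : ∀ᶠ v : HeightOneSpectrum (𝓞 K) in Filter.cofinite, ideleFiniteComponent K v i ∈
      quadraticNormSubgroup (v.adicCompletion K) (algebraMap K (v.adicCompletion K) a) :=
    (he2.and (hea.and hei)).mono fun v hv => mem_quadraticNormSubgroup_of_valued_eq_one v hv.1 hv.2.1 hv.2.2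
  exact Filter.eventually_cofinite.1 h

omit [NumberField K] in
/-- At a COMPLEX place every unit is a local norm (every element of `K_w ≅ ℂ` is a square). [cite: Omeara1963, §65A Example 65:1] -/
theorem quadraticNormSubgroup_completion_eq_top_of_isComplex {w : InfinitePlace K} (hw : w.IsComplex) (b : w.Completion) :
    quadraticNormSubgroup w.Completion b = ⊤ := by
  refine (Subgroup.eq_top_iff' _).2 fun t => mem_quadraticNormSubgroup_of_isSquare b ?_
  have ht : t ∈ Subgroup.square (w.Completion)ˣ := by
    rw [(Subgroup.index_eq_one.1 (index_square_units_completion_of_isComplex hw))]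
    exact Subgroup.mem_top t
  obtain ⟨r, hr⟩ := Subgroup.mem_square.1 ht
  exact ⟨r, by rw [hr, Units.val_mul]⟩

omit [NumberField K] in
/-- At a REAL place where `a` is not a square (`a < 0`) the local norm group `N(ℂ/ℝ) = ℝ_{>0}` has index `2` in `K_wˣ`.
[cite: Omeara1963, §65A Example 65:1] -/
theorem index_quadraticNormSubgroup_completion_eq_two {w : InfinitePlace K} (hw : w.IsReal) {a : w.Completion}
    (ha : ¬ IsSquare a) : (quadraticNormSubgroup w.Completion a).index = 2 := by
  have hle : Subgroup.square (w.Completion)ˣ ≤ quadraticNormSubgroup w.Completion a := by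
    intro t ht
    obtain ⟨r, hr⟩ := Subgroup.mem_square.1 ht
    exact mem_quadraticNormSubgroup_of_isSquare a ⟨r, by rw [hr, Units.val_mul]⟩
  have hdvd : (quadraticNormSubgroup w.Completion a).index ∣ 2 := by
    rw [← index_square_units_completion_of_isReal hw]
    exact Subgroup.index_dvd_of_le hle
  rcases (Nat.dvd_prime Nat.prime_two).1 hdvd with h1 | h2
  · exfalso
    have htop := Subgroup.index_eq_one.1 h1
    exact neg_one_not_mem_quadraticNormSubgroup_of_isReal hw ha (htop ▸ Subgroup.mem_top _)
  · exact h2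

/-! ## §2 `Kˣ · N(𝔸_Mˣ)` is the kernel of the total norm-residue symbol -/

variable {K}

/-- **(→) Reciprocity**: an idèle in `Kˣ · N_{M/K}(𝔸_Mˣ)` is bad at an EVEN number of places (finite + infinite) — a principal idèle
`(θ)` times a norm idèle is bad exactly where `(θ, a)_v = −1`, and Hilbert's reciprocity law 71:18 (★ `hilbertReciprocity_holds`) makes
that number even (★ `even_card_of_mem_principalIdeles_sup_normIdeles`). [cite: Omeara1963, §71 Thm. 71:18] [cite: CasselsFrohlichANT1967, Ch. VII §6 Thm. 6.3] -/
theorem even_ncard_of_mem_principalIdeles_sup_normIdeles {a : K} (ha : a ≠ 0) {i : ideleGroup K}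
    (hi : i ∈ principalIdeles K ⊔ normIdeles K a) :
    Even ({v : HeightOneSpectrum (𝓞 K) | ideleFiniteComponent K v i ∉
        quadraticNormSubgroup (v.adicCompletion K) (algebraMap K (v.adicCompletion K) a)}.ncard +
      {w : InfinitePlace K | ideleInfiniteComponent K w i ∉
        quadraticNormSubgroup w.Completion (algebraMap K w.Completion a)}.ncard) := by
  classical
  have hfin := finite_setOf_ideleFiniteComponent_not_mem_quadraticNormSubgroup ha i
  set T : Finset (InfinitePlace K) := (Set.toFinite {w : InfinitePlace K | ideleInfiniteComponent K w i ∉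
        quadraticNormSubgroup w.Completion (algebraMap K w.Completion a)}).toFinset with hT
  have h := even_card_of_mem_principalIdeles_sup_normIdeles ha (fun θ => hilbertReciprocity_holds K θ a) hi hfin.toFinset T
    (fun v => by rw [Set.Finite.mem_toFinset, Set.mem_setOf_eq]) (fun w => by rw [hT, Set.Finite.mem_toFinset, Set.mem_setOf_eq])
  rwa [← Set.ncard_eq_toFinset_card _ hfin, hT, ← Set.ncard_eq_toFinset_card _ (Set.toFinite _)] at h

/-- **(←) Existence**: if an idèle `i` is bad at an even number of places then `i ∈ Kˣ · N_{M/K}(𝔸_Mˣ)` (`a` not a square): O'Meara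
71:19a supplies `θ ∈ Kˣ` with `(θ, a)_v = −1` exactly at the bad places (where `a` is a local non-square, the bad infinite places being
real), and `(θ)⁻¹ · i` is then a local norm everywhere, the local norm groups having index `≤ 2`.
[cite: Omeara1963, §71 Thm. 71:19 and Cor. 71:19a] [cite: CasselsFrohlichANT1967, Ch. VII §6 Thm. 6.3] -/
theorem mem_principalIdeles_sup_normIdeles_of_even {a : K} (ha : ¬ IsSquare a) {i : ideleGroup K}
    (heven : Even ({v : HeightOneSpectrum (𝓞 K) | ideleFiniteComponent K v i ∉
        quadraticNormSubgroup (v.adicCompletion K) (algebraMap K (v.adicCompletion K) a)}.ncard +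
      {w : InfinitePlace K | ideleInfiniteComponent K w i ∉
        quadraticNormSubgroup w.Completion (algebraMap K w.Completion a)}.ncard)) :
    i ∈ principalIdeles K ⊔ normIdeles K a := by
  classical
  have ha0 : a ≠ 0 := by
    rintro rfl
    exact ha IsSquare.zero
  have hfin := finite_setOf_ideleFiniteComponent_not_mem_quadraticNormSubgroup ha0 i
  set S : Finset (HeightOneSpectrum (𝓞 K)) := hfin.toFinset with hS
  set T : Finset (InfinitePlace K) := (Set.toFinite {w : InfinitePlace K | ideleInfiniteComponent K w i ∉
        quadraticNormSubgroup w.Completion (algebraMap K w.Completion a)}).toFinset with hT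
  have hmemS : ∀ v, v ∈ S ↔ ideleFiniteComponent K v i ∉
      quadraticNormSubgroup (v.adicCompletion K) (algebraMap K (v.adicCompletion K) a) := fun v => by
    rw [hS, Set.Finite.mem_toFinset, Set.mem_setOf_eq]
  have hmemT : ∀ w, w ∈ T ↔ ideleInfiniteComponent K w i ∉
      quadraticNormSubgroup w.Completion (algebraMap K w.Completion a) := fun w => by
    rw [hT, Set.Finite.mem_toFinset, Set.mem_setOf_eq]
  -- `a` is a local non-square at the bad places, and the bad infinite places are real
  have hSq : ∀ v ∈ S, ¬ IsSquare (algebraMap K (v.adicCompletion K) a) := by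
    intro v hv hsq
    haveI : CharZero (v.adicCompletion K) := charZero_of_injective_algebraMap (algebraMap K _).injective
    apply (hmemS v).1 hv
    rw [quadraticNormSubgroup_eq_top_of_isSquare hsq ((map_ne_zero _).2 ha0)]
    exact Subgroup.mem_top _
  have hTq : ∀ w ∈ T, ¬ IsSquare (algebraMap K w.Completion a) := by
    intro w hw hsq
    haveI : CharZero w.Completion := charZero_of_injective_algebraMap (algebraMap K _).injective
    apply (hmemT w).1 hw
    rw [quadraticNormSubgroup_eq_top_of_isSquare hsq ((map_ne_zero _).2 ha0)]
    exact Subgroup.mem_top _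
  have hTreal : ∀ w ∈ T, w.IsReal := by
    intro w hw
    by_contra hr
    apply (hmemT w).1 hw
    rw [quadraticNormSubgroup_completion_eq_top_of_isComplex K (InfinitePlace.not_isReal_iff_isComplex.1 hr)]
    exact Subgroup.mem_top _
  have heven' : Even (S.card + T.card) := by
    rwa [hS, hT, ← Set.ncard_eq_toFinset_card _ hfin, ← Set.ncard_eq_toFinset_card _ (Set.toFinite _)]
  -- O'Meara 71:19a
  obtain ⟨θ, hθ0, hθS, hθT⟩ := exists_hilbertSymbol_eq_neg_one_iff_holds K a S T hTreal heven' hSq hTq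
  -- the principal idèle of `θ`
  let p : ideleGroup K := Units.map (algebraMap K (AdeleRing (𝓞 K) K) : K →* _) (Units.mk0 θ hθ0)
  have hp : p ∈ principalIdeles K := ⟨Units.mk0 θ hθ0, rfl⟩
  -- `p⁻¹ · i` is a norm idèle
  have hn : p⁻¹ * i ∈ normIdeles K a := by
    refine mem_normIdeles_iff.2 ⟨fun v => ?_, fun w => ?_⟩
    · haveI : CharZero (v.adicCompletion K) := charZero_of_injective_algebraMap (algebraMap K _).injective
      have ha' : algebraMap K (v.adicCompletion K) a ≠ 0 := (map_ne_zero _).2 ha0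
      by_cases hsq : IsSquare (algebraMap K (v.adicCompletion K) a)
      · rw [quadraticNormSubgroup_eq_top_of_isSquare hsq ha']
        exact Subgroup.mem_top _
      have h2 := index_quadraticNormSubgroup_adicCompletion_eq_two K v ha' hsq
      rw [map_mul, map_inv, Subgroup.mul_mem_iff_of_index_two h2, Subgroup.inv_mem_iff]
      -- `p_v ∈ N_v ↔ (θ, a)_v = 1 ↔ v ∉ S ↔ i_v ∈ N_v`
      have hpv : ideleFiniteComponent K v p ∈ quadraticNormSubgroup (v.adicCompletion K) (algebraMap K _ a) ↔
          hilbertSymbol (v.adicCompletion K) (algebraMap K _ θ) (algebraMap K _ a) = 1 := by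
        rw [← hilbertSymbol_eq_one_iff_mem_quadraticNormSubgroup ha', ideleFiniteComponent_principal]
        rfl
      rw [hpv, ← not_iff_not, ← ne_eq, hilbertSymbol_ne_one_iff, hθS v, hmemS v]
    · haveI : CharZero w.Completion := charZero_of_injective_algebraMap (algebraMap K _).injective
      have ha' : algebraMap K w.Completion a ≠ 0 := (map_ne_zero _).2 ha0
      by_cases hsq : IsSquare (algebraMap K w.Completion a)
      · rw [quadraticNormSubgroup_eq_top_of_isSquare hsq ha']
        exact Subgroup.mem_top _
      have hreal : w.IsReal := by
        by_contra hr
        exact hsq (by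
          have htop := quadraticNormSubgroup_completion_eq_top_of_isComplex K (InfinitePlace.not_isReal_iff_isComplex.1 hr)
            (algebraMap K w.Completion a)
          -- every unit is a square at a complex place; in particular `a`
          have hmem : Units.mk0 _ ha' ∈ Subgroup.square (w.Completion)ˣ := by
            rw [(Subgroup.index_eq_one.1 (index_square_units_completion_of_isComplex
              (InfinitePlace.not_isReal_iff_isComplex.1 hr)))]
            exact Subgroup.mem_top _
          obtain ⟨r, hr'⟩ := Subgroup.mem_square.1 hmem
          exact ⟨r, by rw [← Units.val_mul, ← hr', Units.val_mk0]⟩)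
      have h2 := index_quadraticNormSubgroup_completion_eq_two K hreal hsq
      rw [map_mul, map_inv, Subgroup.mul_mem_iff_of_index_two h2, Subgroup.inv_mem_iff]
      have hpw : ideleInfiniteComponent K w p ∈ quadraticNormSubgroup w.Completion (algebraMap K _ a) ↔
          hilbertSymbol w.Completion (algebraMap K _ θ) (algebraMap K _ a) = 1 := by
        rw [← hilbertSymbol_eq_one_iff_mem_quadraticNormSubgroup ha', ideleInfiniteComponent_principal]
        rfl
      rw [hpw, ← not_iff_not, ← ne_eq, hilbertSymbol_ne_one_iff, hθT w, hmemT w]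
  have : i = p * (p⁻¹ * i) := by rw [mul_inv_cancel_left]
  rw [this]
  exact Subgroup.mul_mem_sup hp hn

/-- **EXACTNESS OF THE QUADRATIC NORM-RESIDUE SEQUENCE ON IDÈLES.**  For `a ∈ K` not a square and an idèle `i ∈ 𝔸_Kˣ`:
`i ∈ Kˣ · N_{K(√a)/K}(𝔸ˣ)` iff the number of places `v` (finite and infinite) at which `i_v` is NOT a local norm from `K_v(√a)` is even —
i.e. iff the total norm-residue symbol `∏_v (i_v, a)_v` is `+1`; equivalently `Kˣ N(𝔸_Mˣ)` is the kernel of the idelic Artin map of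
`M = K(√a)` [Tate, Cassels–Fröhlich VII §6 Thm. 6.3, §5.1 (B)]. [cite: Omeara1963, §71 Thm. 71:18, Thm. 71:19 and Cor. 71:19a]
[cite: CasselsFrohlichANT1967, Ch. VII §6 Thm. 6.3] -/
theorem mem_principalIdeles_sup_normIdeles_iff_even {a : K} (ha : ¬ IsSquare a) (i : ideleGroup K) :
    i ∈ principalIdeles K ⊔ normIdeles K a ↔
      Even ({v : HeightOneSpectrum (𝓞 K) | ideleFiniteComponent K v i ∉
          quadraticNormSubgroup (v.adicCompletion K) (algebraMap K (v.adicCompletion K) a)}.ncard +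
        {w : InfinitePlace K | ideleInfiniteComponent K w i ∉
          quadraticNormSubgroup w.Completion (algebraMap K w.Completion a)}.ncard) := by
  have ha0 : a ≠ 0 := by
    rintro rfl
    exact ha IsSquare.zero
  exact ⟨even_ncard_of_mem_principalIdeles_sup_normIdeles ha0, mem_principalIdeles_sup_normIdeles_of_even ha⟩

/-! ## §3 The same with the total norm-residue symbol written as a finite product of Hilbert symbols -/

/-- A `±1`-valued function has product `(−1)^{#{f = −1}}` over a finite set. [folklore] -/
private theorem prod_eq_neg_one_pow_card_filter {ι : Type*} [DecidableEq ι] (s : Finset ι) (f : ι → ℤ)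
    (hf : ∀ x ∈ s, f x = 1 ∨ f x = -1) : ∏ x ∈ s, f x = (-1) ^ (s.filter fun x => f x = -1).card := by
  classical
  rw [← Finset.prod_filter_mul_prod_filter_not s (fun x => f x = -1)]
  have h1 : ∏ x ∈ s.filter (fun x => f x = -1), f x = (-1) ^ (s.filter fun x => f x = -1).card := by
    rw [Finset.prod_congr rfl (fun x hx => (Finset.mem_filter.1 hx).2), Finset.prod_const]
  have h2 : ∏ x ∈ s.filter (fun x => ¬ f x = -1), f x = 1 := by
    refine Finset.prod_eq_one fun x hx => ?_
    obtain ⟨hxs, hx1⟩ := Finset.mem_filter.1 hx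
    exact (hf x hxs).resolve_right hx1
  rw [h1, h2, mul_one]

/-- **Exactness, Hilbert-symbol form.**  For `a` not a square, an idèle `i`, and any finite set `S` of finite places outside which `i_v`
is a local norm from `K_v(√a)` (e.g. the bad places, ★ `finite_setOf_ideleFiniteComponent_not_mem_quadraticNormSubgroup`):
`i ∈ Kˣ · N_{K(√a)/K}(𝔸ˣ)` **iff** `∏_{v ∈ S} (i_v, a)_v · ∏_{w ∣ ∞} (i_w, a)_w = 1` — the total norm-residue symbol of `i` is trivial.
[cite: Omeara1963, §71 Thm. 71:18, Thm. 71:19 and Cor. 71:19a] [cite: CasselsFrohlichANT1967, Ch. VII §6 Thm. 6.3] -/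
theorem mem_principalIdeles_sup_normIdeles_iff_prod_hilbertSymbol_eq_one {a : K} (ha : ¬ IsSquare a) (i : ideleGroup K)
    (S : Finset (HeightOneSpectrum (𝓞 K)))
    (hS : ∀ v ∉ S, ideleFiniteComponent K v i ∈ quadraticNormSubgroup (v.adicCompletion K) (algebraMap K (v.adicCompletion K) a)) :
    i ∈ principalIdeles K ⊔ normIdeles K a ↔
      (∏ v ∈ S, hilbertSymbol (v.adicCompletion K) (ideleFiniteComponent K v i : v.adicCompletion K)
          (algebraMap K (v.adicCompletion K) a)) *
        ∏ w : InfinitePlace K, hilbertSymbol w.Completion (ideleInfiniteComponent K w i : w.Completion)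
          (algebraMap K w.Completion a) = 1 := by
  classical
  have ha0 : a ≠ 0 := by
    rintro rfl
    exact ha IsSquare.zero
  rw [mem_principalIdeles_sup_normIdeles_iff_even ha]
  -- the bad sets as filters of `S` and of `univ`
  have hSet : {v : HeightOneSpectrum (𝓞 K) | ideleFiniteComponent K v i ∉
      quadraticNormSubgroup (v.adicCompletion K) (algebraMap K (v.adicCompletion K) a)} =
      ↑(S.filter fun v => hilbertSymbol (v.adicCompletion K) (ideleFiniteComponent K v i : v.adicCompletion K)
        (algebraMap K (v.adicCompletion K) a) = -1) := by
    ext v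
    haveI : CharZero (v.adicCompletion K) := charZero_of_injective_algebraMap (algebraMap K _).injective
    rw [Finset.coe_filter, Set.mem_setOf_eq, Set.mem_setOf_eq,
      hilbertSymbol_eq_neg_one_iff_not_mem_quadraticNormSubgroup ((map_ne_zero _).2 ha0)]
    exact ⟨fun h => ⟨by_contra fun hv => h (hS v hv), h⟩, fun h => h.2⟩
  have hTet : {w : InfinitePlace K | ideleInfiniteComponent K w i ∉ quadraticNormSubgroup w.Completion (algebraMap K w.Completion a)} =
      ↑((Finset.univ : Finset (InfinitePlace K)).filter fun w => hilbertSymbol w.Completion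
        (ideleInfiniteComponent K w i : w.Completion) (algebraMap K w.Completion a) = -1) := by
    ext w
    haveI : CharZero w.Completion := charZero_of_injective_algebraMap (algebraMap K _).injective
    rw [Finset.coe_filter, Set.mem_setOf_eq, Set.mem_setOf_eq,
      hilbertSymbol_eq_neg_one_iff_not_mem_quadraticNormSubgroup ((map_ne_zero _).2 ha0)]
    simp only [Finset.mem_univ, true_and]
  rw [hSet, hTet, Set.ncard_coe_finset, Set.ncard_coe_finset,
    prod_eq_neg_one_pow_card_filter S _ (fun v _ => hilbertSymbol_eq_one_or_eq_neg_one _ _),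
    prod_eq_neg_one_pow_card_filter Finset.univ _ (fun w _ => hilbertSymbol_eq_one_or_eq_neg_one _ _), ← pow_add,
    neg_one_pow_eq_one_iff_even (by decide)]

end Literature.NumberTheory.GaloisRepresentations

end
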